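import Literature.Barriers.CriticalPhenomena.PositionSpaceRGNonGibbsianDiluted
import Literature.Probability.LatticeModels.IsingFieldInsensitivity
import Literature.Probability.LatticeModels.PositiveFieldUniqueness
import HarnessLib

/-!
# Barrier `PositionSpaceRGNonGibbsian` (van Enter–Fernández–Sokal 1993, Theorem 4.2), layer 6:
# Step 2 for the neutralised internal-spin system — insensitivity to the `±` boundary condition
# of the observables at the field-carrying sites (uniqueness, Step 2.2, in finite volume)

Companion of `PositionSpaceRGNonGibbsianDiluted.lean` (which reduced the gap `y - x` of
`VEFS1993_eq412` to ONE finite-volume system: the internal spins `Λ^int_{R'}` on the diluted graph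
`𝔻 = dilutedGraph d`, in the neutralised nonnegative field `h⁰_R = neutralField d R`, with `-`
boundary condition) and of `Literature/Probability/LatticeModels/IsingFieldUniqueness.lean`
(uniqueness at the field-carrying sites of a periodic system, `m⁺_c = m⁻_c`, proved by convexity of
the free energy and the GHS inequality). Here the two are joined (van Enter–Fernández–Sokal
§4.3.1, Step 2.2, p. 110: "The system `⟨R;∞;+⟩` has a unique Gibbs measure … changing the image
spins inside `Λ_R` amounts to a finite-volume perturbation of the system and hence does not alter
the number of Gibbs measures"; footnote 48: "the only change is a shift in the location of the
internal spins in `∂_{R+1}` which feel a nonzero effective field; and this is irrelevant, since we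
replace these fields by zero anyway"):

* `h⁰_R = h^per - 2·𝟙_{nearSites d R}` where `h^per = affCpl 0 (perInd d) 2` is the PERIODIC field
  `2` at every internal site coupled to image spins (`neutralField_eq_perField_sub`); hence the
  tilt identity `⟨F⟩^{±}_{h⁰_R} = ⟨F e^{-2β∑_{k∈K}σ_k}⟩^{±}_{h^per} / ⟨e^{-2β∑_{k∈K}σ_k}⟩^{±}_{h^per}`,
  `K = nearSites d R` (`fieldExpect_neutral_eq_div`) — the "finite-volume perturbation".
* The periodic system satisfies the hypotheses of `exists_volume_plusMag_sub_minusMag_le`: the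
  even translations `x ↦ x + 2z` are automorphisms of `𝔻` preserving `perInd` (`dilutedGraph_adj_evenShift`,
  `perInd_evenShift`), the cubes `{0,1}^d + 2z`, `z ∈ box d n`, tile `tiledCube d n = [-2n, 2n+1]^d`
  disjointly, and `|∂ᵉ tiledCube d n| / |box d n| → 0`; so at every field site `k`,
  `⟨σ_k⟩⁺_{Λ;h^per} - ⟨σ_k⟩⁻_{Λ;h^per} ≤ ε` for all `Λ ⊇ Λ₀(k, ε)` (`exists_volume_plusMag_sub_minusMag_le_diluted`),
  whence along the volumes `Λ^int_{R'}` (`tendsto_plusMag_sub_minusMag_gpiVolume'`; image sites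
  are isolated in `𝔻` and may be discarded, `fieldExpect_fixed_eq_of_sdiff_isolated`).
* Insensitivity for every observable of the spins in `K` (the finite-volume form of "the two
  extremal measures agree"; Friedli–Velenik 2017, proof of Theorem 3.34 via Lemma 3.33 / the FKG
  trick `0 ≤ ⟨n_A⟩⁺ - ⟨n_A⟩⁻ ≤ ∑_{i∈A} (⟨n_i⟩⁺ - ⟨n_i⟩⁻)`), here as
  `|⟨f⟩⁺ - ⟨f⟩⁻| ≤ M ∑_{k∈K} (⟨σ_k⟩⁺ - ⟨σ_k⟩⁻)` for `f` Lipschitz in the spins of `K`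
  (`abs_fieldExpect_plus_sub_minus_le`), which every `K`-local observable is
  (`abs_sub_le_of_local`) — these general lemmas are in
  `Literature/Probability/LatticeModels/IsingFieldInsensitivity.lean`.
* Conclusion (`tendsto_neutral_plus_sub_minus`): for `β > 0` and every `R`,
  `⟨g⟩⁺_{𝔻;Λ^int_{R'};h⁰_R} - ⟨g⟩⁻_{𝔻;Λ^int_{R'};h⁰_R} → 0` as `R' → ∞`, for the gap observable
  `g = e^{2β∑_{y∼0}σ_y} - e^{-2β∑_{y∼0}σ_y}` of `VEFS1993_eq412` (`gapObs`).

The assembly of `VEFS1993_eq412` (with the sibling `VEFS1993_step24_holds`) is in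
`PositionSpaceRGNonGibbsianEq412.lean`.

## References

* A. C. D. van Enter, R. Fernández, A. D. Sokal, J. Stat. Phys. 72 (1993) 879–1167, §4.1.2
  (Step 3, footnote 48), §4.3.1 (Step 2, pp. 108–112).
* S. Friedli, Y. Velenik, *Statistical Mechanics of Lattice Systems* (CUP 2017), §3.6.3,
  Lemma 3.33, Theorem 3.34, Lemma 6.7.
-/

noncomputable section

open MeasureTheory Finset Filter Topology

/-! ## The diluted internal-spin system of the decimation example -/

namespace Literature.Barriers.CriticalPhenomena.NonGibbs

open Literature.Probability.LatticeModels

/-! ### Discarding isolated sites (a general lemma, kept next to its only use) -/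

section Isolated

variable {V : Type*} (G : SimpleGraph V) [DecidableEq V] [G.LocallyFinite]

/-- **Sites of `Λ ∖ Λ'` not adjacent to `Λ'` are invisible to `Λ'`-local observables**: if no
site of `Λ ∖ Λ'` lies in the outer boundary of `Λ'` and `F` depends only on the spins in `Λ'`,
then `⟨F⟩^η_Λ = ⟨F⟩^η_{Λ'}` (DLR consistency and the locality of the inner specification in the
boundary condition, Friedli–Velenik 2017, Lemma 6.7 and §3.6.3, remark after (3.26)); used to
discard isolated sites. [cite: FriedliVelenik2017, Lemma 6.7, eq. (6.5)] -/
theorem fieldExpect_fixed_eq_of_sdiff_isolated {Λ' Λ : Finset V} (hsub : Λ' ⊆ Λ)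
    (hdisj : ∀ x ∈ Λ \ Λ', x ∉ outerBoundary G Λ') (η : SpinConfig V) (β : ℝ) (h : V → ℝ)
    {F : SpinConfig V → ℝ} (hFm : Measurable F)
    (hF : ∀ σ σ' : SpinConfig V, (∀ x ∈ Λ', σ x = σ' x) → F σ = F σ') :
    fieldExpect G Λ β h (.fixed η) F = fieldExpect G Λ' β h (.fixed η) F := by
  refine fieldExpect_fixed_eq_of_forall_inner_eq G hsub η β h hFm fun τ₂ => ?_
  refine fieldExpect_fixed_congr_outerBoundary G (fun y hy => ?_) β h hFm hF
  have hy' : y ∉ Λ \ Λ' := fun h' => hdisj y h' hy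
  rw [glue_apply_of_notMem _ _ _ hy', BoundaryCondition.outside_fixed]

end Isolated

variable (d : ℕ)

/-! ### Field sites, the periodic field and the near sites -/

/-- The indicator of the FIELD SITES: the internal sites coupled to (two) image spins — exactly
one odd coordinate (van Enter–Fernández–Sokal §4.1.2 Step 1: "each internal spin is adjacent
either to two image spins … or else to no image spin"). The periodic field of the system
`⟨∞;+⟩` (all image spins `+`) is `2·perInd` on the internal sites.
[cite: VanenterFernandezSokal1993, §4.1.2 Step 1 and §4.3.1 Step 2.2] -/
def perInd (k : Site d) : ℝ := if (decNbrs d k).Nonempty then 1 else 0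

variable {d}

/-- `0 ≤ perInd ≤ 1`. [cite: VanenterFernandezSokal1993, §4.1.2 Step 1] -/
theorem perInd_nonneg (k : Site d) : 0 ≤ perInd d k := by
  unfold perInd; split_ifs <;> norm_num

/-- A site with a decimated neighbour is internal. [cite: VanenterFernandezSokal1993, §4.1.2 Step 1] -/
theorem not_isDecimatedSite_of_mem_decNbrs {k a : Site d} (ha : a ∈ decNbrs d k) :
    ¬ IsDecimatedSite d k := by
  intro hk
  obtain ⟨hadj, hdec⟩ := (mem_decNbrs d).1 ha
  obtain ⟨i, hi⟩ := (zdGraph_adj_iff k a).1 hadj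
  obtain ⟨m, hm⟩ := hk i
  obtain ⟨m', hm'⟩ := hdec i
  rcases hi with h | h
  · have := congrFun h i
    simp only [Pi.add_apply, Pi.single_eq_same] at this
    omega
  · have := congrFun h i
    simp only [Pi.add_apply, Pi.single_eq_same] at this
    omega

/-- A decimated site whose image lies in `Λ'_R` lies in the cube `box d (2R)`.
[cite: VanenterFernandezSokal1993, §4.3.1 Step 2] -/
theorem mem_box_two_mul_of_ediv_mem_box {R : ℕ} {a : Site d} (ha : IsDecimatedSite d a)
    (h : (fun j => a j / 2) ∈ box d R) : a ∈ box d (2 * R) := by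
  rw [mem_box] at h ⊢
  intro j
  obtain ⟨m, hm⟩ := ha j
  have := h j
  push_cast
  omega

/-- A neighbour of a site of `box d L` lies in `box d (L+1)`. [cite: FriedliVelenik2017, §3.2.1 Exercise 3.1] -/
theorem mem_box_succ_of_adj {L : ℕ} {a k : Site d} (ha : a ∈ box d L) (hadj : (zdGraph d).Adj k a) :
    k ∈ box d (L + 1) := by
  rw [mem_box] at ha ⊢
  obtain ⟨i, hi⟩ := (zdGraph_adj_iff k a).1 hadj
  intro j
  have haj := ha j
  have hs : (Pi.single i (1 : ℤ) : Site d) j = 0 ∨ (Pi.single i (1 : ℤ) : Site d) j = 1 := by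
    by_cases hji : j = i
    · subst hji; simp
    · simp [Pi.single_eq_of_ne hji]
  rcases hi with h | h
  · have := congrFun h j
    simp only [Pi.add_apply] at this
    push_cast
    rcases hs with hs | hs <;> rw [hs] at this <;> omega
  · have := congrFun h j
    simp only [Pi.add_apply] at this
    push_cast
    rcases hs with hs | hs <;> rw [hs] at this <;> omega

/-- Membership in `nearSites d R`: the internal sites with a decimated neighbour whose image
site lies in `Λ'_R` (the cube `box d (2R+1)` in the definition is automatic).
[cite: VanenterFernandezSokal1993, §4.1.2 Step 3, footnote 48] -/
theorem mem_nearSites_iff {R : ℕ} {k : Site d} :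
    k ∈ nearSites d R ↔ ∃ a ∈ decNbrs d k, (fun j => a j / 2) ∈ box d R := by
  rw [nearSites, Finset.mem_filter]
  refine ⟨fun h => h.2, fun h => ⟨?_, h⟩⟩
  obtain ⟨a, ha, hbox⟩ := h
  obtain ⟨hadj, hdec⟩ := (mem_decNbrs d).1 ha
  exact mem_box_succ_of_adj (mem_box_two_mul_of_ediv_mem_box hdec hbox) hadj

/-- Near sites are field sites. [cite: VanenterFernandezSokal1993, §4.1.2 Step 3, footnote 48] -/
theorem decNbrs_nonempty_of_mem_nearSites {R : ℕ} {k : Site d} (hk : k ∈ nearSites d R) :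
    (decNbrs d k).Nonempty := by
  obtain ⟨a, ha, _⟩ := mem_nearSites_iff.1 hk
  exact ⟨a, ha⟩

/-- Near sites are internal. [cite: VanenterFernandezSokal1993, §4.1.2 Step 3, footnote 48] -/
theorem not_isDecimatedSite_of_mem_nearSites {R : ℕ} {k : Site d} (hk : k ∈ nearSites d R) :
    ¬ IsDecimatedSite d k := by
  obtain ⟨a, ha, _⟩ := mem_nearSites_iff.1 hk
  exact not_isDecimatedSite_of_mem_decNbrs ha

/-- `nearSites d R ⊆ Λ^int_{R'}` for `R' ≥ R + 1`. [cite: VanenterFernandezSokal1993, §4.1.2 Step 3, footnote 48] -/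
theorem nearSites_subset_gpiVolume' {R R' : ℕ} (hRR' : R + 1 ≤ R') :
    nearSites d R ⊆ gpiVolume' d R' := fun k hk => by
  have hbox : k ∈ box d (2 * R + 1) := (Finset.mem_filter.1 hk).1
  rw [gpiVolume', Finset.mem_filter]
  exact ⟨box_mono d (by omega) hbox, not_isDecimatedSite_of_mem_nearSites hk⟩

/-- The neighbours of the origin are near sites (the origin is an image site of `Λ'_R`).
[cite: VanenterFernandezSokal1993, §4.1.2 Step 3] -/
theorem neighborFinset_zero_subset_nearSites (R : ℕ) :
    (zdGraph d).neighborFinset 0 ⊆ nearSites d R := fun y hy => by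
  rw [SimpleGraph.mem_neighborFinset] at hy
  refine mem_nearSites_iff.2 ⟨0, (mem_decNbrs d).2 ⟨hy.symm, isDecimatedSite_zero⟩, ?_⟩
  rw [mem_box]
  intro j
  simp only [Pi.zero_apply, Int.zero_ediv]
  omega

/-- **The neutralised field is a finite-volume perturbation of the periodic field**:
`h⁰_R = 2·perInd - 2·𝟙_{nearSites d R}` (footnote 48: "a shift in the location of the internal
spins … which feel a nonzero effective field … we replace these fields by zero").
[cite: VanenterFernandezSokal1993, §4.1.2 Step 3, footnote 48, and §4.3.1 Step 2.2] -/
theorem neutralField_eq_perField_sub (R : ℕ) (k : Site d) :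
    neutralField d R k = affCpl 0 (perInd d) 2 k - 2 * (if k ∈ nearSites d R then 1 else 0) := by
  have hper : affCpl 0 (perInd d) 2 k = 2 * perInd d k := by
    simp only [affCpl, Pi.zero_apply, zero_add]
  rw [hper]
  unfold perInd neutralField
  by_cases hne : (decNbrs d k).Nonempty
  · by_cases hnear : k ∈ nearSites d R
    · obtain ⟨a, ha, hbox⟩ := mem_nearSites_iff.1 hnear
      have hnot : ¬ ((decNbrs d k).Nonempty ∧ ∀ a ∈ decNbrs d k, (fun j => a j / 2) ∉ box d R) :=
        fun h => h.2 a ha hbox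
      rw [ite_cond_eq_false _ _ (eq_false hnot), ite_cond_eq_true _ _ (eq_true hne),
        ite_cond_eq_true _ _ (eq_true hnear)]
      norm_num
    · have hall : (decNbrs d k).Nonempty ∧ ∀ a ∈ decNbrs d k, (fun j => a j / 2) ∉ box d R :=
        ⟨hne, fun a ha hbox => hnear (mem_nearSites_iff.2 ⟨a, ha, hbox⟩)⟩
      rw [ite_cond_eq_true _ _ (eq_true hall), ite_cond_eq_true _ _ (eq_true hne),
        ite_cond_eq_false _ _ (eq_false hnear)]
      norm_num
  · have hnear : k ∉ nearSites d R := fun h => hne (decNbrs_nonempty_of_mem_nearSites h)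
    have hnot : ¬ ((decNbrs d k).Nonempty ∧ ∀ a ∈ decNbrs d k, (fun j => a j / 2) ∉ box d R) :=
      fun h => hne h.1
    rw [ite_cond_eq_false _ _ (eq_false hnot), ite_cond_eq_false _ _ (eq_false hne),
      ite_cond_eq_false _ _ (eq_false hnear)]
    norm_num

/-! ### The tilt from the neutralised to the periodic field -/

variable (d)

/-- The tilt observable `e^{-2β ∑_{k ∈ nearSites d R} σ_k}` relating the neutralised and the
periodic fields. [cite: VanenterFernandezSokal1993, §4.3.1 Step 2.2 ("finite-volume perturbation")] -/
def nearTilt (β : ℝ) (R : ℕ) (σ : SpinConfig (Site d)) : ℝ :=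
  Real.exp (-(2 * β) * ∑ k ∈ nearSites d R, spinAt k σ)

/-- The gap observable `g = e^{2β∑_{y∼0}σ_y} - e^{-2β∑_{y∼0}σ_y}` of `VEFS1993_eq412`.
[cite: VanenterFernandezSokal1993, §4.1.2 Step 3, eqs. (4.10)–(4.12)] -/
def gapObs (β : ℝ) (σ : SpinConfig (Site d)) : ℝ :=
  Real.exp (2 * β * nbrSpinSum (zdGraph d) 0 σ) - Real.exp (-(2 * β * nbrSpinSum (zdGraph d) 0 σ))

variable {d}

/-- Measurability of the tilt. [folklore] -/
theorem measurable_nearTilt (β : ℝ) (R : ℕ) : Measurable (nearTilt d β R) :=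
  Real.measurable_exp.comp ((Finset.measurable_sum _ fun k _ => measurable_spinAt k).const_mul _)

/-- Positivity of the tilt. [folklore] -/
theorem nearTilt_pos (β : ℝ) (R : ℕ) (σ : SpinConfig (Site d)) : 0 < nearTilt d β R σ :=
  Real.exp_pos _

/-- `|∑_{k∈K} σ_k| ≤ #K`. [folklore] -/
theorem abs_sum_spinAt_le (K : Finset (Site d)) (σ : SpinConfig (Site d)) :
    |∑ k ∈ K, spinAt k σ| ≤ K.card := by
  refine (Finset.abs_sum_le_sum_abs _ _).trans ?_
  have : ∑ k ∈ K, |spinAt k σ| = ∑ k ∈ K, (1 : ℝ) := Finset.sum_congr rfl fun k _ => abs_spinAt k σ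
  rw [this, Finset.sum_const, nsmul_eq_mul, mul_one]

/-- Two-sided bounds on the tilt for `β ≥ 0`: `e^{-2β#K} ≤ nearTilt ≤ e^{2β#K}`. [folklore] -/
theorem nearTilt_mem_Icc {β : ℝ} (hβ : 0 ≤ β) (R : ℕ) (σ : SpinConfig (Site d)) :
    nearTilt d β R σ ∈ Set.Icc (Real.exp (-(2 * β * (nearSites d R).card)))
      (Real.exp (2 * β * (nearSites d R).card)) := by
  have h := abs_le.1 (abs_sum_spinAt_le (nearSites d R) σ)
  have hβ2 : 0 ≤ 2 * β := by positivity
  constructor <;> apply Real.exp_le_exp.2 <;> nlinarith [h.1, h.2]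

/-- The tilt depends only on the spins of `nearSites d R`. [folklore] -/
theorem nearTilt_local (β : ℝ) (R : ℕ) (σ σ' : SpinConfig (Site d))
    (h : ∀ k ∈ nearSites d R, σ k = σ' k) : nearTilt d β R σ = nearTilt d β R σ' := by
  unfold nearTilt
  rw [Finset.sum_congr rfl fun k hk => show spinAt k σ = spinAt k σ' by simp only [spinAt, h k hk]]

/-- Measurability of the gap observable. [folklore] -/
theorem measurable_gapObs (β : ℝ) : Measurable (gapObs d β) :=
  (Real.measurable_exp.comp ((measurable_nbrSpinSum (zdGraph d) 0).const_mul _)).sub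
    (Real.measurable_exp.comp ((measurable_nbrSpinSum (zdGraph d) 0).const_mul _).neg)

/-- The gap observable is nondecreasing (for `β ≥ 0`). [cite: VanenterFernandezSokal1993, §4.1.2 Step 3] -/
theorem gapObs_mono {β : ℝ} (hβ : 0 ≤ β) : Monotone (gapObs d β) := fun σ σ' hle => by
  have hN := nbrSpinSum_mono (zdGraph d) 0 hle
  have h2 : 2 * β * nbrSpinSum (zdGraph d) 0 σ ≤ 2 * β * nbrSpinSum (zdGraph d) 0 σ' :=
    mul_le_mul_of_nonneg_left hN (by positivity)
  unfold gapObs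
  exact sub_le_sub (Real.exp_le_exp.2 h2) (Real.exp_le_exp.2 (neg_le_neg h2))

/-- `nbrSpinSum` depends only on the spins at the neighbours. [folklore] -/
theorem nbrSpinSum_congr {W : Type*} (G' : SimpleGraph W) [G'.LocallyFinite] (a : W)
    {σ σ' : SpinConfig W} (h : ∀ y ∈ G'.neighborFinset a, σ y = σ' y) :
    nbrSpinSum G' a σ = nbrSpinSum G' a σ' :=
  Finset.sum_congr rfl fun y hy => by simp only [spinAt, h y hy]

/-- The gap observable depends only on the spins of `nearSites d R`. [cite: VanenterFernandezSokal1993, §4.1.2 Step 3] -/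
theorem gapObs_local (β : ℝ) (R : ℕ) (σ σ' : SpinConfig (Site d))
    (h : ∀ k ∈ nearSites d R, σ k = σ' k) : gapObs d β σ = gapObs d β σ' := by
  unfold gapObs
  rw [nbrSpinSum_congr (zdGraph d) 0 fun y hy => h y (neighborFinset_zero_subset_nearSites R hy)]

/-- The exponent of the field tilt from `h^per` to `h⁰_R` on `Λ^int_{R'}`, `R' ≥ R + 1`:
`∑_{x∈Λ^int_{R'}} (h⁰_R - h^per)_x σ_x = -2 ∑_{k ∈ nearSites d R} σ_k`.
[cite: VanenterFernandezSokal1993, §4.3.1 Step 2.2] -/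
theorem sum_neutralField_sub_perField_mul {R R' : ℕ} (hRR' : R + 1 ≤ R')
    (σ : SpinConfig (Site d)) :
    ∑ x ∈ gpiVolume' d R', (neutralField d R x - affCpl 0 (perInd d) 2 x) * spinAt x σ =
      -2 * ∑ k ∈ nearSites d R, spinAt k σ := by
  have h1 : ∀ x, (neutralField d R x - affCpl 0 (perInd d) 2 x) * spinAt x σ =
      if x ∈ nearSites d R then -2 * spinAt x σ else 0 := fun x => by
    rw [neutralField_eq_perField_sub R x]
    split_ifs <;> ring
  rw [Finset.sum_congr rfl fun x _ => h1 x, ← Finset.sum_filter, Finset.filter_mem_eq_inter,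
    Finset.inter_eq_right.2 (nearSites_subset_gpiVolume' hRR'), Finset.mul_sum]

/-- **The tilt identity** ("changing the image spins inside `Λ_R` amounts to a finite-volume
perturbation", Step 2.2): for `R' ≥ R + 1` and any boundary condition,
`⟨F⟩^{bc}_{𝔻;Λ^int_{R'};h⁰_R} = ⟨F·T⟩^{bc}_{𝔻;Λ^int_{R'};h^per} / ⟨T⟩^{bc}_{𝔻;Λ^int_{R'};h^per}` with
`T = nearTilt d β R`. [cite: VanenterFernandezSokal1993, §4.3.1 Step 2.2] -/
theorem fieldExpect_neutral_eq_div {β : ℝ} {R R' : ℕ} (hRR' : R + 1 ≤ R')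
    (bc : BoundaryCondition (Site d)) {F : SpinConfig (Site d) → ℝ} (hF : Measurable F) :
    fieldExpect (dilutedGraph d) (gpiVolume' d R') β (neutralField d R) bc F =
      fieldExpect (dilutedGraph d) (gpiVolume' d R') β (affCpl 0 (perInd d) 2) bc
          (fun σ => F σ * nearTilt d β R σ) /
        fieldExpect (dilutedGraph d) (gpiVolume' d R') β (affCpl 0 (perInd d) 2) bc
          (nearTilt d β R) := by
  refine fieldExpect_eq_div_of_weight_eq (dilutedGraph d) rfl (measurable_nearTilt β R)
    (fun τ => ?_) hF
  rw [fieldWeight_field_tilt (dilutedGraph d) (gpiVolume' d R') β (affCpl 0 (perInd d) 2)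
    (neutralField d R) bc τ, sum_neutralField_sub_perField_mul hRR']
  unfold nearTilt
  congr 2
  ring

/-! ### The even translations: automorphisms of the diluted system -/

variable (d)

/-- Translation by the even vector `2z`. [cite: VanenterFernandezSokal1993, §4.3.1 Step 2.2 ("periodically diluted lattice")] -/
def evenShift (z : Site d) : Site d ≃ Site d := Site.shift ((2 : ℤ) • z)

variable {d}

/-- `evenShift d z x = x + 2z`. [folklore] -/
@[simp] theorem evenShift_apply (z x : Site d) : evenShift d z x = x + (2 : ℤ) • z := rfl

/-- Decimatedness is invariant under even translations. [cite: VanenterFernandezSokal1993, §4.3.1 Step 2.2] -/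
theorem isDecimatedSite_add_two_smul (x z : Site d) :
    IsDecimatedSite d (x + (2 : ℤ) • z) ↔ IsDecimatedSite d x := by
  refine forall_congr' fun i => ?_
  simp only [Pi.add_apply, Pi.smul_apply, smul_eq_mul]
  exact dvd_add_left (dvd_mul_right 2 (z i))

/-- Even translations are automorphisms of the diluted graph. [cite: VanenterFernandezSokal1993, §4.3.1 Step 2.2] -/
theorem dilutedGraph_adj_evenShift (z x y : Site d) :
    (dilutedGraph d).Adj (evenShift d z x) (evenShift d z y) ↔ (dilutedGraph d).Adj x y := by
  simp only [dilutedGraph_adj, evenShift]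
  rw [zdGraph_adj_shift_iff, Site.shift_apply, Site.shift_apply, isDecimatedSite_add_two_smul,
    isDecimatedSite_add_two_smul]

/-- The decimated neighbours are translated along. [cite: VanenterFernandezSokal1993, §4.3.1 Step 2.2] -/
theorem mem_decNbrs_add_two_smul {z k a : Site d} :
    a ∈ decNbrs d (k + (2 : ℤ) • z) ↔ a - (2 : ℤ) • z ∈ decNbrs d k := by
  rw [mem_decNbrs, mem_decNbrs, ← isDecimatedSite_add_two_smul (a - (2 : ℤ) • z) z,
    sub_add_cancel, ← zdGraph_adj_shift_iff ((2 : ℤ) • z) k (a - (2 : ℤ) • z), Site.shift_apply,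
    Site.shift_apply, sub_add_cancel]

/-- The field-site indicator is invariant under even translations. [cite: VanenterFernandezSokal1993, §4.3.1 Step 2.2] -/
theorem perInd_evenShift (z x : Site d) : perInd d (evenShift d z x) = perInd d x := by
  have hiff : (decNbrs d (x + (2 : ℤ) • z)).Nonempty ↔ (decNbrs d x).Nonempty :=
    ⟨fun ⟨a, ha⟩ => ⟨a - (2 : ℤ) • z, mem_decNbrs_add_two_smul.1 ha⟩,
      fun ⟨a, ha⟩ => ⟨a + (2 : ℤ) • z, mem_decNbrs_add_two_smul.2 (by simpa using ha)⟩⟩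
  simp only [perInd, evenShift_apply, hiff]

/-! ### The tiling of `[-2n, 2n+1]^d` by even translates of the unit cube -/

variable (d)

/-- The cube `[-2n, 2n+1]^d`, tiled by the translates `{0,1}^d + 2z`, `z ∈ box d n`.
[cite: FriedliVelenik2017, §3.2.1] -/
def tiledCube (n : ℕ) : Finset (Site d) :=
  (box d n).biUnion fun z => (halfOpenBox d 2).map (evenShift d z).toEmbedding

variable {d}

/-- Membership in the tiled cube. [cite: FriedliVelenik2017, §3.2.1] -/
theorem mem_tiledCube_iff {n : ℕ} {x : Site d} :
    x ∈ tiledCube d n ↔ ∀ i, -(2 * (n : ℤ)) ≤ x i ∧ x i ≤ 2 * n + 1 := by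
  simp only [tiledCube, Finset.mem_biUnion, Finset.mem_map_equiv, mem_box, mem_halfOpenBox,
    evenShift, Site.shift_symm_apply, Pi.sub_apply, Pi.smul_apply, smul_eq_mul]
  constructor
  · rintro ⟨z, hz, hc⟩ i
    have hzi := hz i
    have hci := hc i
    omega
  · intro h
    refine ⟨fun i => x i / 2, fun i => ?_, fun i => ?_⟩
    · have := h i
      dsimp only
      omega
    · have := h i
      dsimp only
      omega

/-- `box d (2n) ⊆ tiledCube d n ⊆ box d (2n+1)`. [cite: FriedliVelenik2017, §3.2.1] -/
theorem box_subset_tiledCube (n : ℕ) : box d (2 * n) ⊆ tiledCube d n := fun x hx => by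
  rw [mem_box] at hx
  rw [mem_tiledCube_iff]
  intro i
  have := hx i
  push_cast at this
  omega

/-- `tiledCube d n ⊆ box d (2n+1)`. [cite: FriedliVelenik2017, §3.2.1] -/
theorem tiledCube_subset_box (n : ℕ) : tiledCube d n ⊆ box d (2 * n + 1) := fun x hx => by
  rw [mem_tiledCube_iff] at hx
  rw [mem_box]
  intro i
  have := hx i
  push_cast
  omega

/-- The translates of the unit cube by distinct even vectors are disjoint. [cite: FriedliVelenik2017, §3.2.1] -/
theorem pairwiseDisjoint_evenShift_halfOpenBox (S : Finset (Site d)) :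
    (↑S : Set (Site d)).PairwiseDisjoint
      fun z => (halfOpenBox d 2).map (evenShift d z).toEmbedding := by
  intro z _ z' _ hne
  rw [Function.onFun, Finset.disjoint_left]
  intro x hx hx'
  rw [Finset.mem_map_equiv, mem_halfOpenBox] at hx hx'
  apply hne
  funext i
  have h1 := hx i
  have h2 := hx' i
  simp only [evenShift, Site.shift_symm_apply, Pi.sub_apply, Pi.smul_apply, smul_eq_mul] at h1 h2
  omega

/-- The outer boundary of the tiled cube lies in the shell `box d (2n+2) ∖ box d (2n)`.
[cite: FriedliVelenik2017, §3.2.1 Exercise 3.1] -/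
theorem outerBoundary_tiledCube_subset (n : ℕ) :
    outerBoundary (zdGraph d) (tiledCube d n) ⊆ box d (2 * n + 2) \ box d (2 * n) := by
  intro y hy
  rw [mem_outerBoundary_iff] at hy
  obtain ⟨hyT, x, hx, hadj⟩ := hy
  refine Finset.mem_sdiff.2 ⟨?_, fun hyb => hyT (box_subset_tiledCube n hyb)⟩
  have := mem_box_succ_of_adj (tiledCube_subset_box n hx) hadj
  simpa only [show 2 * n + 1 + 1 = 2 * n + 2 by ring] using this

/-- **The tiled cubes are van Hove relative to the number of tiles**:
`|∂ᵉ_𝔻 tiledCube d n| / |box d n| → 0`. [cite: FriedliVelenik2017, §3.2.1 Exercise 3.1] -/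
theorem tendsto_card_edgeBoundary_tiledCube_div :
    Tendsto (fun n => ((edgeBoundary (dilutedGraph d) (tiledCube d n)).card : ℝ) / (box d n).card)
      atTop (𝓝 0) := by
  -- the bound `2d((4n+5)^d - (4n+1)^d) / (2n+1)^d`
  have hbound : ∀ n : ℕ, ((edgeBoundary (dilutedGraph d) (tiledCube d n)).card : ℝ) / (box d n).card ≤
      2 * d * (((4 * (n : ℝ) + 5) / (2 * n + 1)) ^ d - ((4 * (n : ℝ) + 1) / (2 * n + 1)) ^ d) := by
    intro n
    have h1 : (edgeBoundary (dilutedGraph d) (tiledCube d n)).card ≤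
        2 * d * (box d (2 * n + 2) \ box d (2 * n)).card :=
      (Finset.card_le_card (edgeBoundary_mono_graph (dilutedGraph_le d) _)).trans
        ((card_edgeBoundary_le (tiledCube d n)).trans
          (Nat.mul_le_mul_left _ (Finset.card_le_card (outerBoundary_tiledCube_subset n))))
    rw [Finset.card_sdiff_of_subset (box_mono d (by omega)), card_box, card_box] at h1
    have e : (2 * (2 * n + 2) + 1) = 4 * n + 5 := by ring
    have e' : (2 * (2 * n) + 1) = 4 * n + 1 := by ring
    rw [e, e'] at h1
    have hle : (4 * n + 1) ^ d ≤ (4 * n + 5) ^ d := Nat.pow_le_pow_left (by omega) d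
    have hcast : ((edgeBoundary (dilutedGraph d) (tiledCube d n)).card : ℝ) ≤
        2 * d * ((4 * (n : ℝ) + 5) ^ d - (4 * (n : ℝ) + 1) ^ d) := by
      have := (Nat.cast_le (α := ℝ)).2 h1
      push_cast [Nat.cast_sub hle] at this
      exact this
    have key : (2 : ℝ) * d * (((4 * (n : ℝ) + 5) / (2 * n + 1)) ^ d -
        ((4 * (n : ℝ) + 1) / (2 * n + 1)) ^ d) =
        2 * d * ((4 * (n : ℝ) + 5) ^ d - (4 * (n : ℝ) + 1) ^ d) / (2 * (n : ℝ) + 1) ^ d := by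
      rw [div_pow, div_pow, ← sub_div, mul_div_assoc]
    rw [key, card_box]
    push_cast
    rw [div_le_div_iff_of_pos_right (by positivity)]
    exact hcast
  -- the bound tends to `2d(2^d - 2^d) = 0`
  have h0 : Tendsto (fun n : ℕ => 2 * (n : ℝ) + 1) atTop atTop :=
    tendsto_atTop_mono (fun n => by linarith [(Nat.cast_nonneg n : (0 : ℝ) ≤ n)])
      tendsto_natCast_atTop_atTop
  have hq : ∀ c : ℝ, Tendsto (fun n : ℕ => (4 * (n : ℝ) + c) / (2 * n + 1)) atTop (𝓝 2) := by
    intro c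
    have h1 : Tendsto (fun n : ℕ => (c - 2) / (2 * (n : ℝ) + 1)) atTop (𝓝 0) :=
      tendsto_const_nhds.div_atTop h0
    have : Tendsto (fun n : ℕ => 2 + (c - 2) / (2 * (n : ℝ) + 1)) atTop (𝓝 2) := by
      simpa using (tendsto_const_nhds (x := (2 : ℝ))).add h1
    refine this.congr' (Eventually.of_forall fun n => ?_)
    have hpos : (0 : ℝ) < 2 * (n : ℝ) + 1 := by positivity
    field_simp
    ring
  have hlim : Tendsto (fun n : ℕ => 2 * (d : ℝ) * (((4 * (n : ℝ) + 5) / (2 * n + 1)) ^ d -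
      ((4 * (n : ℝ) + 1) / (2 * n + 1)) ^ d)) atTop (𝓝 0) := by
    have := (((hq 5).pow d).sub ((hq 1).pow d)).const_mul (2 * (d : ℝ))
    simpa using this
  refine squeeze_zero (fun n => div_nonneg (Nat.cast_nonneg _) (Nat.cast_nonneg _)) hbound hlim

/-! ### Uniqueness at the field sites of the periodic diluted system -/

/-- **Uniqueness at the field sites of the periodic internal-spin system `⟨∞;+⟩`** (van
Enter–Fernández–Sokal §4.3.1 Step 2.2, "The system has a unique Gibbs measure"; here at the
sites carrying the field, by `exists_volume_plusMag_sub_minusMag_le` — GHS and convexity — rather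
than Lee–Yang): for `β > 0`, a field site `k` and `ε > 0` there is a finite `Λ₀` with
`⟨σ_k⟩⁺_{𝔻;Λ;h^per} - ⟨σ_k⟩⁻_{𝔻;Λ;h^per} ≤ ε` for all `Λ ⊇ Λ₀`.
[cite: VanenterFernandezSokal1993, §4.3.1 Step 2.2] -/
theorem exists_volume_plusMag_sub_minusMag_le_diluted {β : ℝ} (hβ : 0 < β) {k : Site d}
    (hk : (decNbrs d k).Nonempty) {ε : ℝ} (hε : 0 < ε) :
    ∃ Λ₀ : Finset (Site d), ∀ Λ' : Finset (Site d), Λ₀ ⊆ Λ' →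
      plusMag (dilutedGraph d) β (perInd d) Λ' k 2 - minusMag (dilutedGraph d) β (perInd d) Λ' k 2 ≤ ε := by
  -- `k = c + 2z` with `c` in the unit cube
  set z : Site d := fun i => k i / 2 with hz
  set c : Site d := fun i => k i % 2 with hc
  have hkc : k = evenShift d z c := by
    funext i
    simp only [evenShift_apply, Pi.add_apply, Pi.smul_apply, smul_eq_mul, hz, hc]
    omega
  have hcmem : c ∈ halfOpenBox d 2 := by
    rw [mem_halfOpenBox]
    intro i
    simp only [hc]
    omega
  have hvc : 0 < perInd d c := by
    have : perInd d c = perInd d k := by rw [hkc, perInd_evenShift]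
    rw [this, perInd, if_pos hk]
    exact one_pos
  obtain ⟨Λ₀, hΛ₀⟩ := exists_volume_plusMag_sub_minusMag_le (G := dilutedGraph d) (v := perInd d) hβ
    perInd_nonneg two_pos (evenShift d) (fun z x y => dilutedGraph_adj_evenShift z x y)
    (fun z x => perInd_evenShift z x) (halfOpenBox d 2) (box d) (tiledCube d) (fun _ => rfl)
    (fun n => pairwiseDisjoint_evenShift_halfOpenBox (box d n)) (box_nonempty d)
    tendsto_card_edgeBoundary_tiledCube_div hcmem hvc hε
  refine ⟨Λ₀.map (evenShift d z).toEmbedding, ?_⟩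
  rw [hkc]
  exact forall_volume_plusMag_sub_minusMag_le_equiv (dilutedGraph d) (evenShift d z)
    (dilutedGraph_adj_evenShift z) (perInd_evenShift z) hΛ₀

/-- Every finite set of internal sites is eventually inside the volumes `Λ^int_{R'}`.
[cite: VanenterFernandezSokal1993, §4.3.1 Step 2.1] -/
theorem eventually_subset_gpiVolume' (S : Finset (Site d)) (hS : ∀ x ∈ S, ¬ IsDecimatedSite d x) :
    ∀ᶠ R' in atTop, S ⊆ gpiVolume' d R' := by
  obtain ⟨L₀, hL₀⟩ := exists_forall_subset_box d S
  refine eventually_atTop.2 ⟨L₀, fun R' hR' x hx => ?_⟩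
  rw [gpiVolume', Finset.mem_filter]
  exact ⟨hL₀ (2 * R') (by omega) hx, hS x hx⟩

/-- **Uniqueness along the volumes `Λ^int_{R'}`**: for `β > 0` and a field site `k`,
`⟨σ_k⟩⁺_{𝔻;Λ^int_{R'};h^per} - ⟨σ_k⟩⁻_{𝔻;Λ^int_{R'};h^per} → 0` as `R' → ∞` (the image sites of
`Λ₀` are isolated in `𝔻` and may be discarded). [cite: VanenterFernandezSokal1993, §4.3.1 Steps 2.1–2.2] -/
theorem tendsto_plusMag_sub_minusMag_gpiVolume' {β : ℝ} (hβ : 0 < β) {k : Site d}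
    (hk : (decNbrs d k).Nonempty) :
    Tendsto (fun R' => plusMag (dilutedGraph d) β (perInd d) (gpiVolume' d R') k 2 -
      minusMag (dilutedGraph d) β (perInd d) (gpiVolume' d R') k 2) atTop (𝓝 0) := by
  classical
  rw [Metric.tendsto_atTop]
  intro ε hε
  obtain ⟨Λ₀, hΛ₀⟩ := exists_volume_plusMag_sub_minusMag_le_diluted hβ hk (half_pos hε)
  have hkint : ¬ IsDecimatedSite d k := by
    obtain ⟨a, ha⟩ := hk
    exact not_isDecimatedSite_of_mem_decNbrs ha
  set S : Finset (Site d) := insert k (Λ₀.filter fun x => ¬ IsDecimatedSite d x) with hS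
  have hSint : ∀ x ∈ S, ¬ IsDecimatedSite d x := fun x hx => by
    rcases Finset.mem_insert.1 hx with rfl | hx
    · exact hkint
    · exact (Finset.mem_filter.1 hx).2
  obtain ⟨N, hN⟩ := eventually_atTop.1 (eventually_subset_gpiVolume' S hSint)
  refine ⟨N, fun R' hR' => ?_⟩
  have hSsub := hN R' hR'
  have hkW : k ∈ gpiVolume' d R' := hSsub (Finset.mem_insert_self _ _)
  -- the enlarged volume `Λ' = Λ^int_{R'} ∪ (image sites of Λ₀)` contains `Λ₀`
  set D : Finset (Site d) := Λ₀.filter fun x => IsDecimatedSite d x with hD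
  set Λ' : Finset (Site d) := gpiVolume' d R' ∪ D with hΛ'
  have hΛ₀Λ' : Λ₀ ⊆ Λ' := fun x hx => by
    by_cases hdx : IsDecimatedSite d x
    · exact Finset.mem_union_right _ (Finset.mem_filter.2 ⟨hx, hdx⟩)
    · exact Finset.mem_union_left _ (hSsub (Finset.mem_insert_of_mem (Finset.mem_filter.2 ⟨hx, hdx⟩)))
  have hsub : gpiVolume' d R' ⊆ Λ' := Finset.subset_union_left
  have hdisj : ∀ x ∈ Λ' \ gpiVolume' d R', x ∉ outerBoundary (dilutedGraph d) (gpiVolume' d R') := by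
    intro x hx hxb
    obtain ⟨hxΛ', hxW⟩ := Finset.mem_sdiff.1 hx
    rcases Finset.mem_union.1 hxΛ' with h | h
    · exact hxW h
    · exact outerBoundary_dilutedGraph_internal hxb (Finset.mem_filter.1 h).2
  have hloc : ∀ σ σ' : SpinConfig (Site d), (∀ x ∈ gpiVolume' d R', σ x = σ' x) →
      spinAt k σ = spinAt k σ' := fun σ σ' h => by simp only [spinAt, h k hkW]
  have hp : plusMag (dilutedGraph d) β (perInd d) Λ' k 2 =
      plusMag (dilutedGraph d) β (perInd d) (gpiVolume' d R') k 2 :=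
    fieldExpect_fixed_eq_of_sdiff_isolated (dilutedGraph d) hsub hdisj 1 β _ (measurable_spinAt k) hloc
  have hm : minusMag (dilutedGraph d) β (perInd d) Λ' k 2 =
      minusMag (dilutedGraph d) β (perInd d) (gpiVolume' d R') k 2 :=
    fieldExpect_fixed_eq_of_sdiff_isolated (dilutedGraph d) hsub hdisj (-1) β _ (measurable_spinAt k) hloc
  have hle := hΛ₀ Λ' hΛ₀Λ'
  rw [hp, hm] at hle
  have hnn : 0 ≤ plusMag (dilutedGraph d) β (perInd d) (gpiVolume' d R') k 2 -
      minusMag (dilutedGraph d) β (perInd d) (gpiVolume' d R') k 2 :=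
    sub_nonneg.2 (minusMag_le_plusMag hβ.le _ _ k 2)
  rw [Real.dist_eq, sub_zero, abs_of_nonneg hnn]
  linarith

/-! ### Step 2 for the neutralised system: insensitivity of the gap observable -/

/-- **Insensitivity to the `±` boundary condition in the PERIODIC field** of every observable of
the spins in `nearSites d R` (in particular of the gap observable and the tilt), along the
volumes `Λ^int_{R'}`. [cite: VanenterFernandezSokal1993, §4.3.1 Step 2.2] -/
theorem tendsto_per_plus_sub_minus {β : ℝ} (hβ : 0 < β) (R : ℕ) {f : SpinConfig (Site d) → ℝ}
    (hfm : Measurable f)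
    (hloc : ∀ σ σ' : SpinConfig (Site d), (∀ k ∈ nearSites d R, σ k = σ' k) → f σ = f σ') :
    Tendsto (fun R' => fieldExpect (dilutedGraph d) (gpiVolume' d R') β (affCpl 0 (perInd d) 2) .plus f -
      fieldExpect (dilutedGraph d) (gpiVolume' d R') β (affCpl 0 (perInd d) 2) .minus f) atTop (𝓝 0) :=
  tendsto_fieldExpect_plus_sub_minus_of_local (dilutedGraph d) hβ.le _ (gpiVolume' d) (nearSites d R)
    hfm hloc fun _ hk => tendsto_plusMag_sub_minusMag_gpiVolume' hβ (decNbrs_nonempty_of_mem_nearSites hk)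

/-- **Step 2 for the neutralised internal-spin system** (van Enter–Fernández–Sokal §4.3.1,
Steps 2.1–2.3 with footnote 48, in the form needed for (4.12)): for `β > 0` and every `R`,
`⟨g⟩⁺_{𝔻;Λ^int_{R'};β,h⁰_R} - ⟨g⟩⁻_{𝔻;Λ^int_{R'};β,h⁰_R} → 0` as `R' → ∞`, where `g` is the gap
observable of `VEFS1993_eq412`: by the tilt identity both are ratios
`⟨gT⟩^{±}_{h^per} / ⟨T⟩^{±}_{h^per}` of expectations of `nearSites d R`-local observables in the
periodic field, which are insensitive to `±` by uniqueness at the field sites.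
[cite: VanenterFernandezSokal1993, §4.3.1 Step 2, eqs. (4.26)–(4.27)] -/
theorem tendsto_neutral_plus_sub_minus {β : ℝ} (hβ : 0 < β) (R : ℕ) :
    Tendsto (fun R' => fieldExpect (dilutedGraph d) (gpiVolume' d R') β (neutralField d R) .plus (gapObs d β) -
      fieldExpect (dilutedGraph d) (gpiVolume' d R') β (neutralField d R) .minus (gapObs d β))
      atTop (𝓝 0) := by
  set K := nearSites d R with hK
  set T := nearTilt d β R with hT
  have hTm : Measurable T := measurable_nearTilt β R
  have hgm : Measurable (gapObs d β) := measurable_gapObs β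
  have hgTm : Measurable fun σ => gapObs d β σ * T σ := hgm.mul hTm
  have hgTloc : ∀ σ σ' : SpinConfig (Site d), (∀ k ∈ K, σ k = σ' k) →
      gapObs d β σ * T σ = gapObs d β σ' * T σ' := fun σ σ' h => by
    rw [gapObs_local β R σ σ' h, hT, nearTilt_local β R σ σ' h]
  obtain ⟨A, _, hA⟩ := exists_abs_le_of_local K hgTloc
  set b₀ : ℝ := Real.exp (-(2 * β * (nearSites d R).card)) with hb₀
  have hb₀pos : 0 < b₀ := Real.exp_pos _
  -- the four sequences
  set a : ℕ → ℝ := fun R' => fieldExpect (dilutedGraph d) (gpiVolume' d R') β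
    (affCpl 0 (perInd d) 2) .plus (fun σ => gapObs d β σ * T σ)
  set a' : ℕ → ℝ := fun R' => fieldExpect (dilutedGraph d) (gpiVolume' d R') β
    (affCpl 0 (perInd d) 2) .minus (fun σ => gapObs d β σ * T σ)
  set b : ℕ → ℝ := fun R' => fieldExpect (dilutedGraph d) (gpiVolume' d R') β
    (affCpl 0 (perInd d) 2) .plus T
  set b' : ℕ → ℝ := fun R' => fieldExpect (dilutedGraph d) (gpiVolume' d R') β
    (affCpl 0 (perInd d) 2) .minus T
  have ha : ∀ n, |a n| ≤ A := fun n => abs_fieldExpect_le (dilutedGraph d) _ β _ _ hA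
  have ha' : ∀ n, |a' n| ≤ A := fun n => abs_fieldExpect_le (dilutedGraph d) _ β _ _ hA
  have hTge : ∀ σ, b₀ ≤ T σ := fun σ => (nearTilt_mem_Icc hβ.le R σ).1
  have hb : ∀ n, b₀ ≤ b n := fun n => by
    have := fieldExpect_mono_fun (dilutedGraph d) (gpiVolume' d n) β (affCpl 0 (perInd d) 2) .plus
      measurable_const hTm hTge
    rwa [fieldExpect_const_fun] at this
  have hb' : ∀ n, b₀ ≤ b' n := fun n => by
    have := fieldExpect_mono_fun (dilutedGraph d) (gpiVolume' d n) β (affCpl 0 (perInd d) 2) .minus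
      measurable_const hTm hTge
    rwa [fieldExpect_const_fun] at this
  have hda : Tendsto (fun n => a n - a' n) atTop (𝓝 0) := tendsto_per_plus_sub_minus hβ R hgTm hgTloc
  have hdb : Tendsto (fun n => b n - b' n) atTop (𝓝 0) :=
    tendsto_per_plus_sub_minus hβ R hTm (nearTilt_local β R)
  have hlim := tendsto_div_sub_div_atTop_nhds_zero hb₀pos ha ha' hb hb' hda hdb
  refine hlim.congr' ?_
  filter_upwards [eventually_ge_atTop (R + 1)] with R' hR'
  rw [fieldExpect_neutral_eq_div hR' .plus hgm, fieldExpect_neutral_eq_div hR' .minus hgm]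

end Literature.Barriers.CriticalPhenomena.NonGibbs

end
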